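import Summits.ValiantsHypothesis.ValiantsHypothesis.Theorems.KPlusLogSqLawValuativeDoorExchange
import Summits.ValiantsHypothesis.ValiantsHypothesis.Theorems.KPlusLogSqLawValuativeDoorDominantChain

/-!
# LINE `valuative_door` (crux `WeakLifting`, stmt-ValiantsHypothesis-19561) — THE VALUATED-MATROID RUNG: the sharp rank-one bound
# `npEdges ≤ m (K − m)` on DISSOCIATED supports WITHOUT the unit-minor hypothesis

HONEST FRAMING.  Helper (cell `pub-symmetroid`, seat val-sym-lift-p1 g22, 2026-08-29; `--supports 19561 --as helper`).  The landed first target of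
the line, `ValRankOneSharpModularDiss` (p700449), bounds the Newton-polygon edge count of the rank-one lacunary determinant
`det Σ_l X^{d_l} ε_l u_l u_lᵀ` by `m (K − m)` when the `m`-subset sums of `d` are injective (DISSOCIATION) AND all maximal minors of `u` are
`v`-units (the MODULAR case: the log-coefficients are then a modular set function and the optimum at each slope is a top-`m` set of lines).
THIS FILE REMOVES THE UNIT-MINOR HYPOTHESIS (`valRankOneSharpDiss_unfolded`): for every NON-ARCHIMEDEAN `v`, arbitrary vectors `u` and
scalars `ε`, dissociated `d`: `npEdges ≤ m (K − m)`.  The log-coefficients `S ↦ log v(ε(S) det(u_S)²)` are no longer modular but satisfy the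
valuated-matroid exchange inequality (`exchange_coeff_rankOnePencil`, Grassmann–Plücker via Cramer — this is where `IsNonarchimedean` is
USED, unlike in p700449); dominant exponents are dominant sets of that exchange system (`dominant_iff_log`), and an exchange system with
distinct slopes has at most `m (K − m) + 1` dominant sets (`card_dominant_le`: tie families, Gale domination of the top tie, strict growth of
the rank potential along the breakpoint chain).  Degenerate formats (`m = 0`, `K ≤ m`) as in p700449; zero letters need nothing.  This is
the skeleton's conjectured calibration target `ValRankOneSharp` RESTRICTED to dissociated supports — a theorem strictly between the landed
`ValRankOneSharpModularDiss` and the conjectured `ValRankOneSharp` / the content stub `stub_valRankOneLaw` (general `d`: cancellation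
among equal exponents, untouched here).  Closes nothing on the ledger; no bearing on vW / vB, `TropicalB`, `MatrixDescartes` (18050) or
VP ≠ VNP.  [Dress–Wenzel valuated matroids + elementary parametric optimisation]
-/

set_option linter.dupNamespace false
set_option autoImplicit false

namespace Summit.ValiantsHypothesis.ValiantsHypothesis.Theorems.KPlusLogSqLaw.ValDoor

open Polynomial Finset Matrix
open scoped BigOperators Classical

variable {F : Type*} [Field F]

/-- dissociation in selection form gives injectivity of the exponent on `m`-SETS. [bookkeeping] -/
theorem eq_of_sum_eq_of_dissociated {m K : ℕ} (d : Fin K → ℕ)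
    (hdiss : ∀ t t' : Fin m → Fin K, StrictMono t → StrictMono t' → ∑ i, d (t i) = ∑ i, d (t' i) → t = t')
    {S T : Finset (Fin K)} (hS : S.card = m) (hT : T.card = m) (h : ∑ l ∈ S, d l = ∑ l ∈ T, d l) : S = T := by
  obtain ⟨tS, htS, hSimg⟩ := exists_strictMono_image_eq S hS
  obtain ⟨tT, htT, hTimg⟩ := exists_strictMono_image_eq T hT
  rw [← hSimg, ← hTimg, sum_image_eq_sum_of_strictMono d tS htS, sum_image_eq_sum_of_strictMono d tT htT] at h
  rw [← hSimg, ← hTimg, hdiss tS tT htS htT h]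

/-- **CORE COUNT — dominant exponents of a dissociated rank-one pencil are few, for NON-ARCHIMEDEAN `v`, ARBITRARY minors and
ARBITRARY scalars.**  Under dissociation of the `m`-selection sums of `d`, the number of exponents of the rank-one lacunary determinant
that strictly dominate at some radius is at most `m · (K − m) + 1` (zero letters need no separate treatment: their sets simply carry zero
coefficients and are not in the exchange system).  [assembly: `exchange_coeff_rankOnePencil` feeds the abstract `card_dominant_le`] -/
theorem domCount_rankOnePencil_le_diss (v : AbsoluteValue F ℝ) (hv : IsNonarchimedean v) (m K : ℕ) (d : Fin K → ℕ) (ε : Fin K → F)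
    (u : Fin K → Fin m → F)
    (hdiss : ∀ t t' : Fin m → Fin K, StrictMono t → StrictMono t' → ∑ i, d (t i) = ∑ i, d (t' i) → t = t') :
    ((Matrix.det (∑ l, ((X : F[X]) ^ d l) • (ε l • Matrix.vecMulVec (u l) (u l)).map (C : F →+* F[X]))).support.filter
        fun E => ∃ r : ℝ, 0 < r ∧
          ∀ E' ∈ (Matrix.det (∑ l, ((X : F[X]) ^ d l) • (ε l • Matrix.vecMulVec (u l) (u l)).map (C : F →+* F[X]))).support,
            E' ≠ E →
            v ((Matrix.det (∑ l, ((X : F[X]) ^ d l) • (ε l • Matrix.vecMulVec (u l) (u l)).map (C : F →+* F[X]))).coeff E') * r ^ E'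
              < v ((Matrix.det (∑ l, ((X : F[X]) ^ d l) • (ε l • Matrix.vecMulVec (u l) (u l)).map (C : F →+* F[X]))).coeff E) * r ^ E).card
      ≤ m * (K - m) + 1 := by
  set f : F[X] := Matrix.det (∑ l, ((X : F[X]) ^ d l) • (ε l • Matrix.vecMulVec (u l) (u l)).map (C : F →+* F[X])) with hf
  set D := f.support.filter fun E => ∃ r : ℝ, 0 < r ∧ ∀ E' ∈ f.support, E' ≠ E →
      v (f.coeff E') * r ^ E' < v (f.coeff E) * r ^ E with hD
  -- (1) every support exponent is a selection sum
  have hsel : ∀ E ∈ f.support, ∃ t : Fin m → Fin K, StrictMono t ∧ ∑ i, d (t i) = E := by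
    intro E hE
    by_contra hno
    push Not at hno
    have h0 := coeff_det_rankOnePencil_eq_zero m K d ε u E (fun t ht heq => hno t ht heq)
    exact (Polynomial.mem_support_iff.1 hE) (by rw [hf]; exact h0)
  -- (2) the exchange system: supported m-sets, log-coefficients
  set 𝒮 : Finset (Finset (Fin K)) := univ.filter fun S => S.card = m ∧ f.coeff (∑ l ∈ S, d l) ≠ 0 with h𝒮
  set a : Finset (Fin K) → ℝ := fun S => Real.log (v (f.coeff (∑ l ∈ S, d l))) with ha
  have h𝒮mem : ∀ {S : Finset (Fin K)}, S ∈ 𝒮 ↔ S.card = m ∧ f.coeff (∑ l ∈ S, d l) ≠ 0 := by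
    intro S
    rw [h𝒮, Finset.mem_filter]
    exact ⟨fun h => h.2, fun h => ⟨Finset.mem_univ _, h⟩⟩
  have hcard : ∀ S ∈ 𝒮, S.card = m := fun S hS => (h𝒮mem.1 hS).1
  have hE : ∀ S ∈ 𝒮, ∀ T ∈ 𝒮, ∑ l ∈ S, d l = ∑ l ∈ T, d l → S = T :=
    fun S hS T hT h => eq_of_sum_eq_of_dissociated d hdiss (hcard S hS) (hcard T hT) h
  have hX : ∀ A ∈ 𝒮, ∀ B ∈ 𝒮, ∀ i ∈ A \ B, ∃ j ∈ B \ A, insert j (A.erase i) ∈ 𝒮 ∧ insert i (B.erase j) ∈ 𝒮 ∧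
      a A + a B ≤ a (insert j (A.erase i)) + a (insert i (B.erase j)) := by
    intro A hA B hB i hi
    obtain ⟨hAc, hA0⟩ := h𝒮mem.1 hA
    obtain ⟨hBc, hB0⟩ := h𝒮mem.1 hB
    obtain ⟨j, hj, hle⟩ := exchange_coeff_rankOnePencil v hv m K d ε u hdiss A B hAc hBc hA0 hB0 i hi
    obtain ⟨hiA, hiB⟩ := Finset.mem_sdiff.1 hi
    obtain ⟨hjB, hjA⟩ := Finset.mem_sdiff.1 hj
    have hposA : 0 < v (f.coeff (∑ l ∈ A, d l)) := v.pos hA0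
    have hposB : 0 < v (f.coeff (∑ l ∈ B, d l)) := v.pos hB0
    have hpos : 0 < v (f.coeff (∑ l ∈ insert j (A.erase i), d l)) * v (f.coeff (∑ l ∈ insert i (B.erase j), d l)) :=
      lt_of_lt_of_le (mul_pos hposA hposB) hle
    have hposA' : 0 < v (f.coeff (∑ l ∈ insert j (A.erase i), d l)) :=
      lt_of_le_of_ne (v.nonneg _) fun h => by rw [← h, zero_mul] at hpos; exact lt_irrefl _ hpos
    have hposB' : 0 < v (f.coeff (∑ l ∈ insert i (B.erase j), d l)) :=
      lt_of_le_of_ne (v.nonneg _) fun h => by rw [← h, mul_zero] at hpos; exact lt_irrefl _ hpos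
    refine ⟨j, hj, h𝒮mem.2 ⟨?_, (v.pos_iff).1 hposA'⟩, h𝒮mem.2 ⟨?_, (v.pos_iff).1 hposB'⟩, ?_⟩
    · rw [card_exchange hiA hjA, hAc]
    · rw [card_exchange hjB hiB, hBc]
    · have h1 := Real.log_le_log (mul_pos hposA hposB) hle
      rw [Real.log_mul hposA.ne' hposB.ne', Real.log_mul hposA'.ne' hposB'.ne'] at h1
      exact h1
  -- (3) the set of each dominant exponent (junk `∅` off the support)
  choose sel hsel_mono hsel_sum using hsel
  set TS : ℕ → Finset (Fin K) := fun E => if h : E ∈ f.support then univ.image (sel E h) else ∅ with hTS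
  have hTS_of : ∀ E (h : E ∈ f.support), TS E = univ.image (sel E h) := by
    intro E h
    rw [hTS]
    simp only [dif_pos h]
  have hTS_card : ∀ E (h : E ∈ f.support), (TS E).card = m := by
    intro E hE
    rw [hTS_of E hE, Finset.card_image_of_injective _ (hsel_mono E hE).injective, Finset.card_univ, Fintype.card_fin]
  have hTS_sum : ∀ E (h : E ∈ f.support), ∑ l ∈ TS E, d l = E := by
    intro E hE
    rw [hTS_of E hE, sum_image_eq_sum_of_strictMono d (sel E hE) (hsel_mono E hE), hsel_sum E hE]
  have hTS_mem : ∀ E ∈ f.support, TS E ∈ 𝒮 := by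
    intro E hE
    refine h𝒮mem.2 ⟨hTS_card E hE, ?_⟩
    rw [hTS_sum E hE]
    exact Polynomial.mem_support_iff.1 hE
  have hTS_inj : Set.InjOn TS (D : Set ℕ) := by
    intro E hE E' hE' h
    have hEs : E ∈ f.support := (Finset.mem_filter.1 (Finset.mem_coe.1 hE)).1
    have hE's : E' ∈ f.support := (Finset.mem_filter.1 (Finset.mem_coe.1 hE')).1
    rw [← hTS_sum E hEs, ← hTS_sum E' hE's, h]
  -- (4) a dominant exponent gives a dominant set of the exchange system
  have hTS_dom : ∀ E ∈ D, ∃ s : ℝ, ∀ T ∈ 𝒮, T ≠ TS E →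
      a T + s * ((∑ l ∈ T, d l : ℕ) : ℝ) < a (TS E) + s * ((∑ l ∈ TS E, d l : ℕ) : ℝ) := by
    intro E hED
    obtain ⟨hEs, hdom⟩ := Finset.mem_filter.1 hED
    obtain ⟨s, hs⟩ := (exists_dominant_iff_exists_slope v f hEs).1 hdom
    refine ⟨s, fun T hT hTne => ?_⟩
    obtain ⟨hTc, hT0⟩ := h𝒮mem.1 hT
    have hT' : (∑ l ∈ T, d l) ∈ f.support := Polynomial.mem_support_iff.2 hT0
    have hne : (∑ l ∈ T, d l) ≠ E := by
      intro heq
      exact hTne (hE T hT (TS E) (hTS_mem E hEs) (by rw [hTS_sum E hEs]; exact heq))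
    have h1 := hs (∑ l ∈ T, d l) hT' hne
    show Real.log (v (f.coeff (∑ l ∈ T, d l))) + s * ((∑ l ∈ T, d l : ℕ) : ℝ)
      < Real.log (v (f.coeff (∑ l ∈ TS E, d l))) + s * ((∑ l ∈ TS E, d l : ℕ) : ℝ)
    rw [hTS_sum E hEs]
    have e1 : ((∑ l ∈ T, d l : ℕ) : ℝ) * s = s * ((∑ l ∈ T, d l : ℕ) : ℝ) := mul_comm _ _
    have e2 : (E : ℝ) * s = s * (E : ℝ) := mul_comm _ _
    rw [e1, e2] at h1
    exact h1
  -- (5) count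
  have hcardD : D.card = (D.image TS).card := (Finset.card_image_of_injOn hTS_inj).symm
  rw [hcardD]
  have hfam : ∀ T ∈ D.image TS, T ∈ 𝒮 ∧ ∃ s : ℝ, ∀ T' ∈ 𝒮, T' ≠ T →
      a T' + s * ((∑ l ∈ T', d l : ℕ) : ℝ) < a T + s * ((∑ l ∈ T, d l : ℕ) : ℝ) := by
    intro T hT
    obtain ⟨E, hED, rfl⟩ := Finset.mem_image.1 hT
    exact ⟨hTS_mem E (Finset.mem_filter.1 hED).1, hTS_dom E hED⟩
  have hfam_card : ∀ T ∈ D.image TS, T.card = m := fun T hT => hcard T (hfam T hT).1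
  -- degenerate sizes: m = 0 (only `∅`) and K ≤ m (only `univ`)
  by_cases hm0 : m = 0
  · have hsub : D.image TS ⊆ {∅} := fun T hT =>
      Finset.mem_singleton.2 (Finset.card_eq_zero.1 (by rw [hfam_card T hT, hm0]))
    calc (D.image TS).card ≤ ({∅} : Finset (Finset (Fin K))).card := Finset.card_le_card hsub
      _ = 1 := Finset.card_singleton _
      _ ≤ m * (K - m) + 1 := by omega
  by_cases hKm : K ≤ m
  · have hsub : D.image TS ⊆ {univ} := by
      intro T hT
      have h1 := hfam_card T hT
      have h2 : T.card ≤ K := by simpa only [Fintype.card_fin] using Finset.card_le_univ T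
      exact Finset.mem_singleton.2 (Finset.eq_univ_of_card T (by rw [Fintype.card_fin]; omega))
    calc (D.image TS).card ≤ ({univ} : Finset (Finset (Fin K))).card := Finset.card_le_card hsub
      _ = 1 := Finset.card_singleton _
      _ ≤ m * (K - m) + 1 := by omega
  -- main case 0 < m < K: distinct slopes, the abstract count applies
  have hd : Function.Injective d := injective_of_dissociated d (Nat.pos_of_ne_zero hm0) (by omega) hdiss
  exact card_dominant_le 𝒮 a d hd m hcard hX (D.image TS) hfam

/-- **`ValRankOneSharp` ON DISSOCIATED SUPPORTS, WITHOUT UNIT MINORS** (the skeleton's conjectured calibration target `ValRankOneSharp`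
restricted to injective `m`-subset sums; strictly stronger than the landed `ValRankOneSharpModularDiss` p700449, whose unit-minor hypothesis is
dropped and whose unused `IsNonarchimedean` binder is now USED).  For every field `F` of characteristic zero with a NON-ARCHIMEDEAN absolute
value `v`, all `m K`, exponents `d` with injective `m`-subset sums, ARBITRARY scalars `ε` and vectors `u`:
`npEdges = domCount − 1 ≤ m · (K − m)` for the rank-one lacunary determinant, in the skeleton's unfolded currency.  (For `K < m` the
ℕ-truncated bound is `0` and holds because the pencil has rank `≤ K < m`, `det ≡ 0`; for `m = 0`, `det = 1`.)  [assembly] -/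
theorem valRankOneSharpDiss_unfolded :
    ∀ (F : Type) [Field F] [CharZero F] (v : AbsoluteValue F ℝ), IsNonarchimedean v →
      ∀ (m K : ℕ) (d : Fin K → ℕ) (ε : Fin K → F) (u : Fin K → Fin m → F),
        Function.Injective (fun I : {s : Finset (Fin K) // s.card = m} => ∑ l ∈ I.1, d l) →
        ((Matrix.det (∑ l, ((Polynomial.X : Polynomial F) ^ d l) •
            (ε l • Matrix.vecMulVec (u l) (u l)).map Polynomial.C)).support.filter fun E => ∃ r : ℝ, 0 < r ∧
            ∀ E' ∈ (Matrix.det (∑ l, ((Polynomial.X : Polynomial F) ^ d l) •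
              (ε l • Matrix.vecMulVec (u l) (u l)).map Polynomial.C)).support, E' ≠ E →
              v ((Matrix.det (∑ l, ((Polynomial.X : Polynomial F) ^ d l) •
                (ε l • Matrix.vecMulVec (u l) (u l)).map Polynomial.C)).coeff E') * r ^ E'
              < v ((Matrix.det (∑ l, ((Polynomial.X : Polynomial F) ^ d l) •
                (ε l • Matrix.vecMulVec (u l) (u l)).map Polynomial.C)).coeff E) * r ^ E).card - 1
          ≤ m * (K - m) := by
  intro F _ _ v hv m K d ε u hinj
  refine Nat.sub_le_iff_le_add.2 ?_
  -- dissociation in selection form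
  have hdiss : ∀ t t' : Fin m → Fin K, StrictMono t → StrictMono t' → ∑ i, d (t i) = ∑ i, d (t' i) → t = t' := by
    intro t t' ht ht' hsum
    have hI : (univ.image t).card = m := by
      rw [Finset.card_image_of_injective _ ht.injective, Finset.card_univ, Fintype.card_fin]
    have hI' : (univ.image t').card = m := by
      rw [Finset.card_image_of_injective _ ht'.injective, Finset.card_univ, Fintype.card_fin]
    have hsums : ∑ l ∈ univ.image t, d l = ∑ l ∈ univ.image t', d l := by
      rw [sum_image_eq_sum_of_strictMono d t ht, sum_image_eq_sum_of_strictMono d t' ht']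
      exact hsum
    have hsub : (⟨univ.image t, hI⟩ : {s : Finset (Fin K) // s.card = m}) = ⟨univ.image t', hI'⟩ := hinj hsums
    exact strictMono_eq_of_image_eq ht ht' (congrArg Subtype.val hsub)
  exact domCount_rankOnePencil_le_diss v hv m K d ε u hdiss

end Summit.ValiantsHypothesis.ValiantsHypothesis.Theorems.KPlusLogSqLaw.ValDoor
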